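import Summits.CriticalPhenomena.CardyFormulaZ2.Theorems.CardyFlipRussoVoronoiHubFromSmirnovOneArmDefs

/-!
# Stubs `hybStep_pivotal`, `chainArm_of_pivotal` of line `moebius-exact-delaunay-dilation-ward`
# (crux `VoronoiHubFromSmirnov`, stmt-CriticalPhenomena-6433, route `CardyFlipRusso`)

Deterministic core of ONE telescoping step of the re-planned stub S3b-i (Benjamini–Schramm,
*Conformal invariance of Voronoi percolation*, Comm. Math. Phys. 197 (1998), §4 and §9 (9.1), read
square by square).  The chain crossing event `adjCross` is compared for the hybrid adjacencies
`adjHyb S` and `adjHyb (insert i S)` (switch one more square `i` of side `ℓ` from `E₁` to `E₂`).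

* `hybStep_pivotal`: if switching square `i` changes the truth value of the chain event, then
  (a) the square carries a DEFECT PAIR (`DefSq`): the chain witnessing the true side has a
  consecutive pair on which the two hybrids differ; by `adjHyb_insert_iff_of_ne` such a pair has an
  endpoint in square `i`, where the enlarged hybrid is `E₂` (`adjHyb_of_mem`) and the two hybrids can
  only differ if `E₁ ≠ E₂` on the pair; and (b) whitening the square destroys the event on the true
  side: a chain of `b ∖ square` avoids square `i`, so both hybrids agree on all its pairs and it
  would witness the false side (`b ∖ square ⊆ b`).
* `chainArm_of_pivotal`: if the chain event holds for `b` but not for `b ∖ square`, the chain visits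
  square `i`, hence passes within `ℓ` of its centre; walking from that visit to the far attachment
  (the `A₂` end: keep the tail; the `A₀` end: reverse the head, using the symmetry of `E`) gives a
  chain arm `ChainArm E (sqCentre ℓ i) ℓ R K δ b`.

Elementary: logic on chains, re-indexing of sub-chains by values (`Fin.ext` + `omega`), and the
bound `‖z‖ ≤ |re z| + |im z|` for a point of a square of side `ℓ` around its centre.
-/

noncomputable section

namespace Summit.CriticalPhenomena.CardyFormulaZ2.Cruxes.VoronoiHubFromSmirnov.MoebiusExactDelaunayDilationWard

open Set

/-! ### Sub-chains -/

/-- Value form of the consecutive-pair adjacency of a chain: indices with consecutive values are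
adjacent. -/
theorem hs_adj_of_val_eq {N : ℕ} {E : ℂ → ℂ → Prop} {p : Fin (N + 1) → ℂ}
    (hE : ∀ k : Fin N, E (p k.castSucc) (p k.succ)) (a c : Fin (N + 1))
    (h : (c : ℕ) = (a : ℕ) + 1) : E (p a) (p c) := by
  have ha : (a : ℕ) < N := by have := c.isLt; omega
  have h1 : (Fin.castSucc ⟨a, ha⟩ : Fin (N + 1)) = a := Fin.ext rfl
  have h2 : (Fin.succ ⟨a, ha⟩ : Fin (N + 1)) = c :=
    Fin.ext (by simp only [Fin.val_succ]; omega)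
  have e := hE ⟨a, ha⟩
  rw [h1, h2] at e
  exact e

/-- The tail of a chain from one of its indices `j` is a chain from `p j` to the last point. -/
theorem hs_chain_tail {N : ℕ} {E : ℂ → ℂ → Prop} {p : Fin (N + 1) → ℂ}
    (hE : ∀ k : Fin N, E (p k.castSucc) (p k.succ)) (j : Fin (N + 1)) :
    ∃ (M : ℕ) (q : Fin (M + 1) → ℂ), (∀ m, ∃ k, q m = p k) ∧ q 0 = p j ∧
      q (Fin.last M) = p (Fin.last N) ∧ ∀ m : Fin M, E (q m.castSucc) (q m.succ) := by
  have hj := j.isLt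
  refine ⟨N - j, fun m => p ⟨(j : ℕ) + (m : ℕ), by have := m.isLt; omega⟩, fun m => ⟨_, rfl⟩,
    ?_, ?_, fun m => ?_⟩
  · exact congrArg p (Fin.ext (by simp))
  · exact congrArg p (Fin.ext (by simp; omega))
  · exact hs_adj_of_val_eq hE _ _ (by simp only [Fin.val_succ, Fin.val_castSucc]; omega)

/-- The head of a chain up to one of its indices `j`, reversed, is a chain from `p j` to the first
point, for a symmetric adjacency. -/
theorem hs_chain_head_rev {N : ℕ} {E : ℂ → ℂ → Prop} (hsymm : ∀ p q : ℂ, E p q → E q p)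
    {p : Fin (N + 1) → ℂ} (hE : ∀ k : Fin N, E (p k.castSucc) (p k.succ)) (j : Fin (N + 1)) :
    ∃ (M : ℕ) (q : Fin (M + 1) → ℂ), (∀ m, ∃ k, q m = p k) ∧ q 0 = p j ∧
      q (Fin.last M) = p 0 ∧ ∀ m : Fin M, E (q m.castSucc) (q m.succ) := by
  have hj := j.isLt
  refine ⟨j, fun m => p ⟨(j : ℕ) - (m : ℕ), by omega⟩, fun m => ⟨_, rfl⟩, ?_, ?_, fun m => ?_⟩
  · exact congrArg p (Fin.ext (by simp))
  · exact congrArg p (Fin.ext (by simp))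
  · apply hsymm
    have hm := m.isLt
    exact hs_adj_of_val_eq hE _ _ (by simp only [Fin.val_succ, Fin.val_castSucc]; omega)

/-! ### Geometry of squares -/

/-- A point of the square of index `i` (side `ℓ > 0`) is within `ℓ` of its centre (indeed within
`ℓ / √2`; each coordinate is within `ℓ / 2`). -/
theorem hs_dist_sqCentre_le {ℓ : ℝ} (hℓ : 0 < ℓ) {p : ℂ} {i : ℤ × ℤ} (h : sqIdx ℓ p = i) :
    dist p (sqCentre ℓ i) ≤ ℓ := by
  obtain ⟨i₁, i₂⟩ := i
  simp only [sqIdx, Prod.mk.injEq] at h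
  obtain ⟨h1, h2⟩ := h
  have hcoord : ∀ (x : ℝ) (n : ℤ), ⌊x / ℓ⌋ = n → |x - ((n : ℝ) + 1 / 2) * ℓ| ≤ ℓ / 2 := by
    intro x n hn
    have ha := Int.floor_le (x / ℓ)
    have hb := Int.lt_floor_add_one (x / ℓ)
    rw [hn] at ha hb
    rw [le_div_iff₀ hℓ] at ha
    rw [div_lt_iff₀ hℓ] at hb
    rw [abs_le]
    constructor <;> nlinarith
  have hre := hcoord p.re i₁ h1
  have him := hcoord p.im i₂ h2
  have ere : (p - sqCentre ℓ (i₁, i₂)).re = p.re - ((i₁ : ℝ) + 1 / 2) * ℓ := by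
    simp [sqCentre]
  have eim : (p - sqCentre ℓ (i₁, i₂)).im = p.im - ((i₂ : ℝ) + 1 / 2) * ℓ := by
    simp [sqCentre]
  rw [Complex.dist_eq]
  calc ‖p - sqCentre ℓ (i₁, i₂)‖
        ≤ |(p - sqCentre ℓ (i₁, i₂)).re| + |(p - sqCentre ℓ (i₁, i₂)).im| :=
          Complex.norm_le_abs_re_add_abs_im _
    _ ≤ ℓ / 2 + ℓ / 2 := by rw [ere, eim]; exact add_le_add hre him
    _ = ℓ := by ring

/-! ### The two registered stubs -/

/-- **One telescoping step is pivotal only through a defective square** (Benjamini–Schramm 1998,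
§4, §9 (9.1), square by square).  If switching the adjacency of one more square `i` (from the
hybrid `adjHyb S` to `adjHyb (insert i S)`) changes the truth value of the chain crossing event,
then, in either direction, (a) square `i` carries a defect pair (`DefSq`: a pair of chain points,
one in the square, on which `E₁` and `E₂` disagree) and (b) removing the black nuclei of square `i`
destroys the event on the side where it held. -/
theorem hybStep_pivotal : ∀ (S : Set (ℤ × ℤ)) (ℓ : ℝ) (E₁ E₂ : ℂ → ℂ → Prop) (i : ℤ × ℤ) (K A₀ A₂ : Set ℂ) (δ : ℝ) (b : Set ℂ), (adjCross (adjHyb S ℓ E₁ E₂) K A₀ A₂ δ b → ¬ adjCross (adjHyb (insert i S) ℓ E₁ E₂) K A₀ A₂ δ b → DefSq E₁ E₂ ℓ i K δ b ∧ ¬ adjCross (adjHyb S ℓ E₁ E₂) K A₀ A₂ δ (b \ {p | sqIdx ℓ p = i})) ∧ (adjCross (adjHyb (insert i S) ℓ E₁ E₂) K A₀ A₂ δ b → ¬ adjCross (adjHyb S ℓ E₁ E₂) K A₀ A₂ δ b → DefSq E₁ E₂ ℓ i K δ b ∧ ¬ adjCross (adjHyb (insert i S) ℓ E₁ E₂)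 K A₀ A₂ δ (b \ {p | sqIdx ℓ p = i})) := by
  intro S ℓ E₁ E₂ i K A₀ A₂ δ b
  refine ⟨fun hS hnot => ⟨?_, fun hdiff => ?_⟩, fun hI hnot => ⟨?_, fun hdiff => ?_⟩⟩
  · -- (a), direction `S` true / `insert i S` false
    obtain ⟨N, p, hb, hK, h0, hN, hE⟩ := hS
    have hex : ∃ k : Fin N, ¬ adjHyb (insert i S) ℓ E₁ E₂ (p k.castSucc) (p k.succ) :=
      not_forall.1 fun hall => hnot ⟨N, p, hb, hK, h0, hN, hall⟩
    obtain ⟨k, hk⟩ := hex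
    have hki : sqIdx ℓ (p k.castSucc) = i ∨ sqIdx ℓ (p k.succ) = i := by
      by_contra hne
      obtain ⟨hne₁, hne₂⟩ := not_or.1 hne
      exact hk ((adjHyb_insert_iff_of_ne E₁ E₂ hne₁ hne₂).2 (hE k))
    have hmem : sqIdx ℓ (p k.castSucc) ∈ insert i S ∨ sqIdx ℓ (p k.succ) ∈ insert i S :=
      hki.imp (fun h => mem_insert_iff.2 (Or.inl h)) (fun h => mem_insert_iff.2 (Or.inl h))
    have h2 : ¬ E₂ (p k.castSucc) (p k.succ) := fun h => hk ((adjHyb_of_mem E₁ E₂ hmem).2 h)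
    have h1 : E₁ (p k.castSucc) (p k.succ) := by
      by_cases hm : sqIdx ℓ (p k.castSucc) ∈ S ∨ sqIdx ℓ (p k.succ) ∈ S
      · exact absurd ((adjHyb_of_mem E₁ E₂ hm).1 (hE k)) h2
      · exact (adjHyb_of_not_mem E₁ E₂ hm).1 (hE k)
    exact ⟨p k.castSucc, p k.succ, hb _, hb _, hK _, hK _, hki, fun hiff => h2 (hiff.1 h1)⟩
  · -- (b), direction `S`: a chain avoiding square `i` is a chain for the enlarged hybrid
    obtain ⟨N, p, hb, hK, h0, hN, hE⟩ := hdiff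
    exact hnot ⟨N, p, fun k => (hb k).1, hK, h0, hN, fun k =>
      (adjHyb_insert_iff_of_ne E₁ E₂ (hb k.castSucc).2 (hb k.succ).2).2 (hE k)⟩
  · -- (a), direction `insert i S` true / `S` false
    obtain ⟨N, p, hb, hK, h0, hN, hE⟩ := hI
    have hex : ∃ k : Fin N, ¬ adjHyb S ℓ E₁ E₂ (p k.castSucc) (p k.succ) :=
      not_forall.1 fun hall => hnot ⟨N, p, hb, hK, h0, hN, hall⟩
    obtain ⟨k, hk⟩ := hex
    have hki : sqIdx ℓ (p k.castSucc) = i ∨ sqIdx ℓ (p k.succ) = i := by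
      by_contra hne
      obtain ⟨hne₁, hne₂⟩ := not_or.1 hne
      exact hk ((adjHyb_insert_iff_of_ne E₁ E₂ hne₁ hne₂).1 (hE k))
    have hmem : sqIdx ℓ (p k.castSucc) ∈ insert i S ∨ sqIdx ℓ (p k.succ) ∈ insert i S :=
      hki.imp (fun h => mem_insert_iff.2 (Or.inl h)) (fun h => mem_insert_iff.2 (Or.inl h))
    have h2 : E₂ (p k.castSucc) (p k.succ) := (adjHyb_of_mem E₁ E₂ hmem).1 (hE k)
    have h1 : ¬ E₁ (p k.castSucc) (p k.succ) := by
      intro h1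
      by_cases hm : sqIdx ℓ (p k.castSucc) ∈ S ∨ sqIdx ℓ (p k.succ) ∈ S
      · exact hk ((adjHyb_of_mem E₁ E₂ hm).2 h2)
      · exact hk ((adjHyb_of_not_mem E₁ E₂ hm).2 h1)
    exact ⟨p k.castSucc, p k.succ, hb _, hb _, hK _, hK _, hki, fun hiff => h1 (hiff.2 h2)⟩
  · -- (b), direction `insert i S`
    obtain ⟨N, p, hb, hK, h0, hN, hE⟩ := hdiff
    exact hnot ⟨N, p, fun k => (hb k).1, hK, h0, hN, fun k =>
      (adjHyb_insert_iff_of_ne E₁ E₂ (hb k.castSucc).2 (hb k.succ).2).1 (hE k)⟩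

/-- **A pivotal square carries a chain arm** (graph form of the one-arm event of the route).  If the
`E`-chain crossing holds for the black nuclei `b` but fails once the nuclei of square `i` are
removed, then the chain visits square `i`, hence passes within `ℓ` of its centre; if moreover one
of the attachment sets lies at distance `> R` from the centre (configuration coordinates), walking
along the chain from the visit to that attachment (reversing the chain if it is the `A₀` end, by the
symmetry of `E`) gives an `E`-chain arm from `B̄(centre, ℓ)` to distance `≥ R`. -/
theorem chainArm_of_pivotal : ∀ (E : ℂ → ℂ → Prop) (ℓ R : ℝ) (i : ℤ × ℤ) (K A₀ A₂ : Set ℂ) (δ : ℝ) (b : Set ℂ), 0 < ℓ → (∀ p q : ℂ, E p q → E q p) → adjCross E K A₀ A₂ δ b → ¬ adjCross E K A₀ A₂ δ (b \ {p | sqIdx ℓ p = i}) → ((∀ x : ℂ, (δ : ℂ) * x ∈ A₀ → R < dist x (sqCentre ℓ i)) ∨ (∀ x : ℂ, (δ : ℂ) * x ∈ A₂ → R < dist x (sqCentre ℓ i))) → ChainArm E (sqCentre ℓ i) ℓ R K δ b := by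
  intro E ℓ R i K A₀ A₂ δ b hℓ hsymm hcross hnot hfar
  obtain ⟨N, p, hb, hK, h0, hN, hE⟩ := hcross
  -- the chain visits square `i`, else it is a chain of `b ∖ square`
  have hex : ∃ j : Fin (N + 1), sqIdx ℓ (p j) = i := by
    by_contra hall
    push Not at hall
    exact hnot ⟨N, p, fun k => ⟨hb k, hall k⟩, hK, h0, hN, hE⟩
  obtain ⟨j, hj⟩ := hex
  have hdist : dist (p j) (sqCentre ℓ i) ≤ ℓ := hs_dist_sqCentre_le hℓ hj
  rcases hfar with hA | hA
  · -- the `A₀` end is far: reverse the head of the chain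
    obtain ⟨M, q, hq, hq0, hqM, hqE⟩ := hs_chain_head_rev hsymm hE j
    refine ⟨M, q, fun m => ?_, fun m => ?_, ?_, ?_, hqE⟩
    · obtain ⟨k, hk⟩ := hq m
      rw [hk]
      exact hb k
    · obtain ⟨k, hk⟩ := hq m
      rw [hk]
      exact hK k
    · rw [hq0]
      exact hdist
    · rw [hqM]
      exact (hA _ h0).le
  · -- the `A₂` end is far: keep the tail of the chain
    obtain ⟨M, q, hq, hq0, hqM, hqE⟩ := hs_chain_tail hE j
    refine ⟨M, q, fun m => ?_, fun m => ?_, ?_, ?_, hqE⟩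
    · obtain ⟨k, hk⟩ := hq m
      rw [hk]
      exact hb k
    · obtain ⟨k, hk⟩ := hq m
      rw [hk]
      exact hK k
    · rw [hq0]
      exact hdist
    · rw [hqM]
      exact (hA _ hN).le

end Summit.CriticalPhenomena.CardyFormulaZ2.Cruxes.VoronoiHubFromSmirnov.MoebiusExactDelaunayDilationWard

end
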